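import Summits.PneNP.PneNP.Theorems.SfmBlMachineGreedy
import Summits.PneNP.PneNP.Theorems.SfmBlMachineHatFP
import Literature.Computability.Complexity.MurrayWilliams2018MachineB
import Literature.Computability.QuantumComplexity.HidingProgramMachine

/-!
# Line «sfm-bl», MACHINE LAYER M5-GREEDY (typing): the greedy signing is a polynomial-time string function (stmt-PneNP-20523)

FRONTIER F-N1c; nothing here bears on P vs NP.

`CodeFP` typings of the spec of `SfmBlMachineGreedy`, composed from the landed typings of M1 (`codeFP_pieceLegs`),
M2 (`codeFP_cands`, `codeFP_extract`), M3a (`codeFP_rlegs`, `codeFP_traceSum`), M4 (`codeFP_allRecs`,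
`codeFP_hatSum`), the tree's `natSize_code` / `natSizeU_codeFP` (bit sizes) and the decoder (`codeFP_runs`, `codeFP_tripsTok`): every parameter / cap / static datum as a
function of the context `(m, trips)` (caps and round counts in UNARY through polynomial unit budgets `unitsPow`,
clamped numerals through `unOfNatMin` — the clamps of the spec make these conversions exact on every input), the
per-step potential `codeFP_potVal`, the step `codeFP_greedyStep`, the loop `codeFP_greedyRun` (`CodeFP.foldl`,
accumulator = the bits), **`codeFP_sfmStr : CodeFP strE strE sfmStr`**, hence **`sfmStr_mem_FP`** and
**`isPolyTime_sfmStr : IsPolyTime sfmStr`** (bridge `isPolyTime_iff`).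
-/

set_option linter.dupNamespace false -- `Summit.PneNP.PneNP.…`: summit = sub-problem name (D-0017 single-conjunct layout)

namespace Summit.PneNP.PneNP.Theorems.SfmBlMachine

open Literature.Computability.Complexity CodeFP
open Summit.PneNP.PneNP.Theorems.Nc03AvoidResidualCoreCandFewHeadsRungFP

section PolyTime

open Polynomial

/-- Code of the context `(m, trips)` (`m` in unary, triples in binary). -/
abbrev σE : ℕ × List (ℕ × ℕ × ℕ) → List Bool := pairE unE (rawE tripN)

/-- The pieced legs. -/
theorem cPlegs : CodeFP σE (rawE plegE) (fun t => sfmPlegs t.2) := ((codeFP_pieceLegs L0).comp (snd _ _)).congr fun _ => rfl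

/-- `N` in binary. -/
theorem cNn : CodeFP σE natE (fun t => sfmN t.2) := ((natLength labE).comp (codeFP_pieces.comp cPlegs)).congr fun _ => rfl

/-- `N` in unary. -/
theorem cNu : CodeFP σE unE (fun t => sfmN t.2) := ((ulength labE).comp (codeFP_pieces.comp cPlegs)).congr fun _ => rfl

/-- `40N` in binary. -/
theorem c40Nn : CodeFP σE natE (fun t => 40 * sfmN t.2) := (natMul.comp ((const _ (40 : ℕ)).pair cNn)).congr fun _ => rfl

/-- `40N` in unary. -/
theorem c40Nu : CodeFP σE unE (fun t => 40 * sfmN t.2) := ((unMulConst 40).comp cNu).congr fun _ => rfl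

/-- `j + 1` in unary. -/
theorem cJ1u : CodeFP σE unE (fun t => prmJ1 (sfmN t.2)) :=
  (Literature.Computability.QuantumComplexity.natSizeU_codeFP.comp (Literature.Computability.Complexity.SatCode.natSize_code.comp
    (natMul.comp ((const _ (20 : ℕ)).pair cNn)))).congr fun _ => rfl

/-- `2^(j+1)` in binary (`dsimp` rather than `rfl`: definitional unfolding of `^` must be avoided). -/
theorem c2J1 : CodeFP σE natE (fun t => 2 ^ prmJ1 (sfmN t.2)) :=
  (natPow.comp ((const _ (2 : ℕ)).pair cJ1u)).congr fun _ => by dsimp only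

/-- `t₀` in binary. -/
theorem cT0 : CodeFP σE natE (fun t => prmT0 (sfmN t.2)) :=
  (natDiv.comp ((natAdd.comp ((natMul.comp ((const _ (2 : ℕ)).pair c2J1)).pair
    (natMul.comp ((const _ (2 : ℕ)).pair (Literature.Computability.Complexity.SatCode.natSize_code.comp cNn))))).pair
    (const _ (10 : ℕ)))).congr fun _ => rfl

/-- `t₀'` in binary. -/
theorem cT0' : CodeFP σE natE (fun t => prmT0' (sfmN t.2)) := (natMin.comp (cT0.pair c40Nn)).congr fun _ => rfl

/-- `t₀'` in unary (the clamp makes the conversion exact). -/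
theorem cT0'u : CodeFP σE unE (fun t => prmT0' (sfmN t.2)) :=
  (unOfNatMin.comp (c40Nu.pair cT0')).congr fun t => min_eq_left (by unfold prmT0'; exact min_le_right _ _)

/-- `q + 1` (clamped) in binary. -/
theorem cQ1' : CodeFP σE natE (fun t => prmQ1' (sfmN t.2)) := (natMin.comp (c2J1.pair c40Nn)).congr fun _ => rfl

/-- `q + 1` (clamped) in unary. -/
theorem cQ1'u : CodeFP σE unE (fun t => prmQ1' (sfmN t.2)) :=
  (unOfNatMin.comp (c40Nu.pair cQ1')).congr fun t => min_eq_left (by unfold prmQ1'; exact min_le_right _ _)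

/-- The rounds `2(t₀' − 1)` of the candidate walks, as units. -/
theorem cUW : CodeFP σE (rawE unitE) (fun t => List.replicate (2 * (prmT0' (sfmN t.2) - 1)) ()) := by
  have hn : CodeFP σE natE (fun t => 2 * (prmT0' (sfmN t.2) - 1)) :=
    (natMul.comp ((const _ (2 : ℕ)).pair (natSub.comp (cT0'.pair (const _ (1 : ℕ)))))).congr fun _ => rfl
  have hu : CodeFP σE unE (fun t => 2 * (prmT0' (sfmN t.2) - 1)) :=
    (unOfNatMin.comp (((unMulConst 2).comp cT0'u).pair hn)).congr fun t => min_eq_left (by omega)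
  exact (replicateUnit.comp hu).congr fun _ => rfl

/-- The walk cap `(40N)^121` in unary. -/
theorem cCapWu : CodeFP σE unE (fun t => sfmCapW t.2) :=
  ((ulength unitE).comp ((unitsPow 121).comp c40Nu)).congr fun t => by
    show (List.replicate ((40 * sfmN t.2) ^ 121) ()).length = sfmCapW t.2
    rw [List.length_replicate]; rfl

/-- The candidate pairs. -/
theorem cCands : CodeFP σE (rawE candE) (fun t => sfmCands t.2) :=
  (codeFP_cands.comp (((cPlegs.pair cCapWu).pair cUW).pair cT0')).congr fun _ => rfl

/-- The extraction output. -/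
theorem cExtract : CodeFP σE xstE (fun t => sfmExtract t.2) := by
  have hr : CodeFP σE (rawE unitE) (fun t => List.replicate ((sfmPlegs t.2).length + 1) ()) :=
    (replicateUnit.comp (unSucc.comp ((ulength plegE).comp cPlegs))).congr fun _ => rfl
  exact (codeFP_extract.comp (((cPlegs.pair cCands).pair (const _ γsq0)).pair hr)).congr fun _ => rfl

/-- The labels. -/
theorem cLabels : CodeFP σE (rawE natE) (fun t => (sfmExtract t.2).1) := cExtract.fst'

/-- `r'` in binary. -/
theorem cR'n : CodeFP σE natE (fun t => sfmR' t.2) :=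
  (natMin.comp (cExtract.snd'.pair (natAdd.comp (((natLength plegE).comp cPlegs).pair (const _ (1 : ℕ)))))).congr
    fun _ => rfl

/-- `r'` in unary (the clamp makes the conversion exact). -/
theorem cR'u : CodeFP σE unE (fun t => sfmR' t.2) :=
  (unOfNatMin.comp ((unSucc.comp ((ulength plegE).comp cPlegs)).pair cR'n)).congr fun t =>
    min_eq_left (by unfold sfmR'; exact min_le_right _ _)

/-- The remainder legs. -/
theorem cRlegs : CodeFP σE (rawE plegE) (fun t => sfmRlegs t.2) := (codeFP_rlegs.comp (cPlegs.pair cLabels)).congr fun _ => rfl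

/-- The rounds `2(q+1) − 1` of the alternating sequences, as units. -/
theorem cUA : CodeFP σE (rawE unitE) (fun t => sfmUA t.2) := by
  have hn : CodeFP σE natE (fun t => 2 * prmQ1' (sfmN t.2) - 1) :=
    (natSub.comp ((natMul.comp ((const _ (2 : ℕ)).pair cQ1')).pair (const _ (1 : ℕ)))).congr fun _ => rfl
  have hu : CodeFP σE unE (fun t => 2 * prmQ1' (sfmN t.2) - 1) :=
    (unOfNatMin.comp (((unMulConst 2).comp cQ1'u).pair hn)).congr fun t => min_eq_left (by omega)
  exact (replicateUnit.comp hu).congr fun _ => rfl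

/-- The alternating-sequence cap `3m·(40N)^240` in unary. -/
theorem cCapAu : CodeFP σE unE (fun t => sfmCapA t.2) :=
  ((ulength unitE).comp (unitsMul.comp ((replicateUnit.comp (codeFP_threeLen.comp (snd _ _))).pair
    ((unitsPow 240).comp c40Nu)))).congr fun t => by
      show (List.replicate ((List.replicate (3 * t.2.length) ()).length * (List.replicate ((40 * sfmN t.2) ^ 240) ()).length) ()).length
        = sfmCapA t.2
      simp only [List.length_replicate]; rfl

/-- The pair records of all spots. -/
theorem cRecs : CodeFP σE (rawE precE) (fun t => sfmRecs t.2) :=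
  (codeFP_allRecs.comp ((c40Nu.pair cCapWu).pair ((cPlegs.pair cLabels).pair cR'u))).congr fun _ => rfl

/-- `V = Σ_s (|V₁ s| + |V₂ s|)` in binary. -/
theorem cV : CodeFP σE natE (fun t => sfmV t.2) := by
  have hs : CodeFP (pairE (pairE (rawE plegE) (rawE natE)) natE) natE
      (fun q => (lpieces (slegs q.1.1 q.1.2 q.2)).length + (rpieces (slegs q.1.1 q.1.2 q.2)).length) :=
    (natAdd.comp ((((natLength labE).comp (codeFP_lpieces.comp codeFP_slegs))).pair
      ((natLength labE).comp (codeFP_rpieces.comp codeFP_slegs)))).congr fun _ => rfl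
  exact (natSum.comp ((map hs).comp ((cPlegs.pair cLabels).pair (urange.comp cR'u)))).congr fun _ => rfl

/-- `ℓ = 2(q+1)` in unary. -/
theorem cEllu : CodeFP σE unE (fun t => sfmEll t.2) := ((unMulConst 2).comp cQ1'u).congr fun _ => rfl

/-- `20^ℓ` in binary. -/
theorem c20ℓ : CodeFP σE natE (fun t => 20 ^ sfmEll t.2) := (natPow.comp ((const _ (20 : ℕ)).pair cEllu)).congr fun _ => by dsimp only

/-- `2^(60ℓ)` in binary. -/
theorem c2pow60ℓ : CodeFP σE natE (fun t => 2 ^ (60 * sfmEll t.2)) :=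
  (natPow.comp ((const _ (2 : ℕ)).pair ((unMulConst 60).comp cEllu))).congr fun _ => by dsimp only

/-- `C₁` in binary. -/
theorem cC₁ : CodeFP σE natE (fun t => sfmC₁ t.2) :=
  (natMul.comp ((natMul.comp ((const _ (6 : ℕ)).pair (natAdd.comp ((natMul.comp ((const _ (4 : ℕ)).pair cV)).pair
    (const _ ((2 ^ 60) ^ 10 : ℕ)))))).pair c20ℓ)).congr fun _ => rfl

/-- `C₂` in binary. -/
theorem cC₂ : CodeFP σE natE (fun t => sfmC₂ t.2) :=
  (natMul.comp ((natMul.comp ((const _ (10 : ℕ)).pair (natAdd.comp ((natMul.comp (cNn.pair c2pow60ℓ)).pair c20ℓ)))).pair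
      (const _ (5 * (2 ^ 60) ^ 10 : ℕ)))).congr fun _ => rfl

/-- Code of the step input `((m, trips), (kk, T₀))`. -/
abbrev stE : (ℕ × List (ℕ × ℕ × ℕ)) × (ℕ × List Bool) → List Bool := pairE σE (pairE natE (rawE bitE))

/-- **The scaled potential is polynomial time** (input `((m, trips), (kk, T₀))`). -/
theorem codeFP_potVal : CodeFP stE intE (fun q => potVal q.1.1 q.1.2 q.2.1 q.2.2) := by
  -- `pw = 2^(m − kk + 1)` through the unary exponent (`≤ m + 1`)
  have hen : CodeFP stE natE (fun q => q.1.1 - q.2.1 + 1) :=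
    (natAdd.comp ((natSub.comp ((natOfUn.comp (fst _ _).fst').pair (snd _ _).fst')).pair (const _ (1 : ℕ)))).congr
      fun _ => rfl
  have heu : CodeFP stE unE (fun q => q.1.1 - q.2.1 + 1) :=
    (unOfNatMin.comp ((unSucc.comp (fst _ _).fst').pair hen)).congr fun q => min_eq_left (by omega)
  have hpw : CodeFP stE intE (fun q => (2 : ℤ) ^ (q.1.1 - q.2.1 + 1)) :=
    (intPow.comp ((const _ (2 : ℤ)).pair heu)).congr fun _ => by dsimp only
  have hts : CodeFP stE intE (fun q => traceSum q.2.1 q.2.2 (2 ^ (q.1.1 - q.2.1 + 1)) (sfmRlegs q.1.2) (sfmCapA q.1.2) (sfmUA q.1.2)) :=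
    (codeFP_traceSum.comp ((((cRlegs.comp (fst _ _)).pair (cCapAu.comp (fst _ _))).pair (cUA.comp (fst _ _))).pair
      ((snd _ _).pair hpw))).congr fun q => by dsimp only
  have hhs : CodeFP stE intE (fun q => (hatSum G0 q.2.1 q.2.2 q.1.1 (sfmRecs q.1.2) : ℤ)) :=
    (intOfNat.comp (codeFP_hatSum.comp ((((const _ G0).pair (snd _ _).fst').pair ((snd _ _).snd'.pair (fst _ _).fst')).pair
      (cRecs.comp (fst _ _))))).congr fun _ => rfl
  exact (intAdd.comp ((intMul.comp ((intOfNat.comp (cC₁.comp (fst _ _))).pair hts)).pair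
    (intMul.comp ((intOfNat.comp (cC₂.comp (fst _ _))).pair hhs)))).congr fun q => by unfold potVal; dsimp only

/-- **One greedy step is polynomial time** (input `((m, trips), ((), acc))`, the shape of `CodeFP.foldl`). -/
theorem codeFP_greedyStep : CodeFP (pairE σE (pairE unitE (rawE bitE))) (rawE bitE) (fun q => greedyStep q.1.1 q.1.2 q.2.2) := by
  have hacc : CodeFP (pairE σE (pairE unitE (rawE bitE))) (rawE bitE) (fun q => q.2.2) := (snd _ _).snd'
  have hkk : CodeFP (pairE σE (pairE unitE (rawE bitE))) natE (fun q => q.2.2.length + 1) :=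
    (natAdd.comp (((natLength bitE).comp hacc).pair (const _ (1 : ℕ)))).congr fun _ => rfl
  have hext : ∀ b : Bool, CodeFP (pairE σE (pairE unitE (rawE bitE))) (rawE bitE) (fun q => q.2.2 ++ [b]) := fun b =>
    ((rawAppend bitE).comp (hacc.pair (const _ [b]))).congr fun _ => rfl
  have hpot : ∀ b : Bool, CodeFP (pairE σE (pairE unitE (rawE bitE))) intE
      (fun q => potVal q.1.1 q.1.2 (q.2.2.length + 1) (q.2.2 ++ [b])) := fun b =>
    (codeFP_potVal.comp ((fst _ _).pair (hkk.pair (hext b)))).congr fun _ => rfl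
  exact ((intLe.comp ((hpot false).pair (hpot true))).ite (hext false) (hext true)).congr fun q => by
    unfold greedyStep
    simp only [decide_eq_true_eq]

/-- **The greedy loop is polynomial time** (input `((m, trips), u)`; accumulator = the bits, one per step). -/
theorem codeFP_greedyRun : CodeFP (pairE σE (rawE unitE)) (rawE bitE) (fun p => greedyRun p.1.1 p.1.2 p.2) := by
  have h := foldl (σ := ℕ × List (ℕ × ℕ × ℕ)) (α := Unit) (β := List Bool) (eσ := σE) (eα := unitE) (eβ := rawE bitE)
    (step := fun s _ acc => greedyStep s.1 s.2 acc) (init := fun _ => []) codeFP_greedyStep (const σE ([] : List Bool))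
    (4 * X) (fun s l₁ l₂ => by
      set n := (pairE σE (rawE unitE) (s, l₁ ++ l₂)).length with hn
      have hl₁ : l₁.length ≤ n := by
        have := length_le_length_rawE unitE (l₁ ++ l₂)
        rw [List.length_append] at this
        rw [hn]; simp only [pairE_apply, length_boolPair]; omega
      have hlen : (l₁.foldl (fun acc (_ : Unit) => greedyStep s.1 s.2 acc) []).length = l₁.length := length_greedyRun s.1 s.2 l₁
      have hitem : ∀ b ∈ l₁.foldl (fun acc (_ : Unit) => greedyStep s.1 s.2 acc) [], (bitE b).length ≤ 1 := fun b _ => by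
        simp [bitE]
      have h1 := length_rawE_le_of_forall hitem
      rw [hlen] at h1
      have heval : (4 * X : Polynomial ℕ).eval n = 4 * n := by simp
      show (rawE bitE (l₁.foldl (fun acc (_ : Unit) => greedyStep s.1 s.2 acc) [])).length ≤ _
      rw [heval]; omega)
  exact h.congr fun p => rfl

/-- **The greedy signing is polynomial time** (input `(m, trips)`). -/
theorem codeFP_greedyBits : CodeFP σE (rawE bitE) (fun t => greedyBits t.1 t.2) :=
  (codeFP_greedyRun.comp ((CodeFP.id σE).pair (replicateUnit.comp (fst _ _)))).congr fun _ => rfl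

/-- **THE MACHINE IS A POLYNOMIAL-TIME STRING FUNCTION** (`strE = id` on both sides). -/
theorem codeFP_sfmStr : CodeFP strE strE sfmStr :=
  (bitsToStr.comp (codeFP_greedyBits.comp ((codeFP_mTok.pair (codeFP_tripsN.comp codeFP_tripsTok)).comp codeFP_runs))).congr
    fun _ => rfl

/-- **`sfmStr ∈ FP`.** -/
theorem sfmStr_mem_FP : sfmStr ∈ FP := by
  obtain ⟨f, hf, hfw⟩ := codeFP_sfmStr
  have h : f = sfmStr := funext fun w => hfw w
  rw [← h]
  exact hf

/-- **`sfmStr` is polynomial-time computable** (`IsPolyTime`, the predicate of `CandCutNormSigningFP`; bridge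
`isPolyTime_iff`). -/
theorem isPolyTime_sfmStr : IsPolyTime sfmStr := (isPolyTime_iff sfmStr).mpr sfmStr_mem_FP

end PolyTime

end Summit.PneNP.PneNP.Theorems.SfmBlMachine
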